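import Summits.HubbardSuperconductivity.HubbardSuperconductivity.Theorems.SoloBlindHoleHopShell
import Literature.MathematicalPhysics.QuantumLattice.HubbardGroundStateLatticeCovariance
import HarnessLib

/-!
# The endpoint of every sign-free floor on the `L × L` torus
# (Proposition 43 / Corollary 43′-lite, kernel form — generation 60)

Solo-blind programme `HubbardSuperconductivity`, generation 60.

**Theorem (`exists_holeShell_charge_ge`).** On the `L × L` torus, `L ≥ 3` (nearest-neighbour
graph `fermionTorusGraph 2 L`, `4`-regular: the tree's `card_filter_fermionTorusGraph_adj`), for
every hole number
`1 ≤ E ≤ L²` and every AM–GM admissible weight scheme `u` on hole hops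
(`u(H→H') ≥ 0`, `u(H→H') · u(H'→H) ≥ 1` — the lineage's `u = 2w`, `4 w w' ≥ 1`, Theorems 34′/42),
some `E`-hole configuration `H ⊆ Λ_L` collects the charge
`C_u(H) = Σ_{(x,y): x ∼ y, x ∉ H, y ∈ H} u(H → insert x (H.erase y)) ≥ 4 E (L² - E)/(L² - 1)`,
in particular (`exists_holeShell_charge_ge_density`) `≥ 4 E (L² - E)/L² = 4 ρ (1 - ρ) L²`,
`ρ = E/L²`.

Proof: `SoloBlindReciprocalCharge` (the adjacency form of the hole-hop graph is dominated by the
diagonal charge form, so the maximal charge is at least the mean degree of any vertex set) and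
`SoloBlindHoleHopShell` (the mean degree of the `E`-shell of a `D`-regular graph on `n` vertices is
`D E (n-E)/(n-1)`), with `D = 4` from the tree's `card_filter_fermionTorusGraph_adj`
(`HubbardGroundStateLatticeCovariance`; `L ≥ 3`: the four neighbours `x ± e₁, x ± e₂` are distinct).

Reading (paper §5.20(19), Corollary 43′): every kinetic floor of the type of Theorems 34 / 34′ /
34″ / 42 / 42′ — fermion signs dropped by `|hop| ≤` (`MottCounting.norm_hop_le`), then reciprocal
AM–GM on each hole hop with configuration-dependent weights — reads `re ⟨ψ, T ψ⟩ ≥ -max_s C_u(s) ‖ψ‖²`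
on the doublon-free `E`-hole shell, and its constant can never be below `4 ρ (1-ρ) L²`; against
the dimer condensate's crutch gain `(g/2) δ (1-δ) L² + O(g)` (Theorem 33) this forces the
certification threshold `g ≥ 8 - O(L⁻²)` for the whole sign-free road (α), strictly above the
floor-method ceiling `g₁(δ) < 8` (Theorem 35′).  The spins of the electrons ride along (uniform
fibres over the hole sets) and change no count.  Corollary-grade: a ceiling on a sub-method of the
crutch-axis method; W3 untouched.

[this work]
-/

namespace Summit.HubbardSuperconductivity.HubbardSuperconductivity.Theorems.SignFreeFloorEndpoint

open Finset Literature.Probability.LatticeModels Literature.MathematicalPhysics.QuantumLattice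
open Summit.HubbardSuperconductivity.HubbardSuperconductivity.Theorems.HoleHopShell

variable {L : ℕ} [NeZero L]

omit [NeZero L] in
/-- `|Λ_L| = L²` for the fermionic square torus (file-local copy of a folklore fact). -/
private theorem card_fermionTorus : Fintype.card (FermionTorus 2 L) = L ^ 2 := by
  simp [FermionTorus, Fintype.card_lex]

/-- **The endpoint of every sign-free floor (Proposition 43 with `φ ≡ 1`, torus form).** For
`L ≥ 3`, `1 ≤ E ≤ L²` and every AM–GM admissible weight scheme `u` on the hole hops of the
`L × L` torus, some `E`-hole configuration collects the charge
`Σ_{(x,y) mixed} u(H → insert x (H.erase y)) ≥ 4 E (L² - E)/(L² - 1)` — the mean degree of the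
hole-hop graph on the `E`-shell. [this work] -/
theorem exists_holeShell_charge_ge (hL : 3 ≤ L) {E : ℕ} (hE : 1 ≤ E) (hEL : E ≤ L ^ 2)
    (u : Finset (FermionTorus 2 L) → Finset (FermionTorus 2 L) → ℝ)
    (hu : ∀ H H' : Finset (FermionTorus 2 L),
      (∃ x y, (fermionTorusGraph 2 L).Adj x y ∧ x ∉ H ∧ y ∈ H ∧ H' = insert x (H.erase y)) →
        0 ≤ u H H')
    (huu : ∀ H H' : Finset (FermionTorus 2 L),
      (∃ x y, (fermionTorusGraph 2 L).Adj x y ∧ x ∉ H ∧ y ∈ H ∧ H' = insert x (H.erase y)) →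
        1 ≤ u H H' * u H' H) :
    ∃ H : Finset (FermionTorus 2 L), H.card = E ∧
      (4 * E * ((L : ℝ) ^ 2 - E)) / ((L : ℝ) ^ 2 - 1) ≤
        ∑ p ∈ (univ ×ˢ univ).filter (fun p : FermionTorus 2 L × FermionTorus 2 L =>
            (fermionTorusGraph 2 L).Adj p.1 p.2 ∧ p.1 ∉ H ∧ p.2 ∈ H),
          u H (insert p.1 (H.erase p.2)) := by
  have hcard : Fintype.card (FermionTorus 2 L) = L ^ 2 := card_fermionTorus
  have hn : 2 ≤ Fintype.card (FermionTorus 2 L) := by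
    rw [hcard]
    nlinarith
  have hEn : E ≤ Fintype.card (FermionTorus 2 L) := by rwa [hcard]
  obtain ⟨H, hH, hle⟩ := exists_shell_charge_ge (fermionTorusGraph 2 L) (D := 4)
    (card_filter_fermionTorusGraph_adj hL) hn hE hEn u hu huu
  refine ⟨H, hH, ?_⟩
  rw [hcard] at hle
  push_cast at hle
  exact hle

/-- **Density form**: the same configuration has charge `≥ 4 E (L² - E)/L² = 4 ρ(1-ρ) L²`,
`ρ = E/L²` (since `L² - 1 < L²`).  Against the dimer condensate's gain `(g/2) δ(1-δ) L² + O(g)`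
this is the threshold `g ≥ 8 - O(L⁻²)` of Corollary 43′. [this work] -/
theorem exists_holeShell_charge_ge_density (hL : 3 ≤ L) {E : ℕ} (hE : 1 ≤ E) (hEL : E ≤ L ^ 2)
    (u : Finset (FermionTorus 2 L) → Finset (FermionTorus 2 L) → ℝ)
    (hu : ∀ H H' : Finset (FermionTorus 2 L),
      (∃ x y, (fermionTorusGraph 2 L).Adj x y ∧ x ∉ H ∧ y ∈ H ∧ H' = insert x (H.erase y)) →
        0 ≤ u H H')
    (huu : ∀ H H' : Finset (FermionTorus 2 L),
      (∃ x y, (fermionTorusGraph 2 L).Adj x y ∧ x ∉ H ∧ y ∈ H ∧ H' = insert x (H.erase y)) →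
        1 ≤ u H H' * u H' H) :
    ∃ H : Finset (FermionTorus 2 L), H.card = E ∧
      (4 * E * ((L : ℝ) ^ 2 - E)) / (L : ℝ) ^ 2 ≤
        ∑ p ∈ (univ ×ˢ univ).filter (fun p : FermionTorus 2 L × FermionTorus 2 L =>
            (fermionTorusGraph 2 L).Adj p.1 p.2 ∧ p.1 ∉ H ∧ p.2 ∈ H),
          u H (insert p.1 (H.erase p.2)) := by
  obtain ⟨H, hH, hle⟩ := exists_holeShell_charge_ge hL hE hEL u hu huu
  refine ⟨H, hH, le_trans ?_ hle⟩
  have hL2 : (3 : ℝ) ^ 2 ≤ (L : ℝ) ^ 2 := by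
    have : (3 : ℝ) ≤ L := by exact_mod_cast hL
    nlinarith
  have hEL' : (E : ℝ) ≤ (L : ℝ) ^ 2 := by exact_mod_cast hEL
  have hnum : 0 ≤ 4 * (E : ℝ) * ((L : ℝ) ^ 2 - E) := by
    have : (0 : ℝ) ≤ E := by positivity
    nlinarith
  exact div_le_div_of_nonneg_left hnum (by nlinarith) (by linarith)

end Summit.HubbardSuperconductivity.HubbardSuperconductivity.Theorems.SignFreeFloorEndpoint
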